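import Mathlib
import HarnessLib
import Literature.MathematicalPhysics.QuantumFieldTheory.BalabanBanachStep

/-!
# Strategist census (seat cstrat-s1, 2026-08-17) — typed statements for `STRATEGY-CENSUS.md`
# crux `ContinuumLegGivenGap` (stmt-QuantumFields-15828)

Nothing here is filed as an item; these `def`s make the census entries precise (each elaborates, `lean check` rc 0):

* `SetUVEngine` — child 2 of the split (= registered `stub_uvPackageVol`, SET-shaped torus family) verbatim;
* `TailUVEngine` — STRENGTHEN S1: the TAIL-shaped variant suggested by the c14 audit of `stub_floorAndRotation`
  (`𝓛 k := {L | Λ₀ k ≤ L}`); `setUVEngine_of_tail : TailUVEngine → SetUVEngine` PROVED — the strengthening is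
  genuine and one-directional; it buys no rigidity for the UV step and EXCLUDES engines needing arithmetic torus sizes
  (the RP-chessboard line needs triadic `2L+1 = 3^M`), which is why child 2 stays SET-shaped;
* `zmCorr`, `ZeroMomentumFloor` — DECOMPOSITION D3 / TRANSFER T1: the (ND) two-point floor re-typed in infrared
  currency: the zero-momentum connected plaquette (curvature-species) correlator on the odd torus at time `n ≍ 1/m̂_k`
  is `≥ c · m̂_k⁵` (canonical power counting `a⁵Λ⁵`; "the plaquette running coupling reaches order one before the
  correlation length"; equivalently a k-uniform floor on the canonically normalised residue of the lightest
  `0⁺⁺` state = the scalar-glueball decay constant);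
* `NDOfZeroMomentumFloor` — the RP/positivity bridge (plausibly M/L, NOT proved here): the zero-momentum floor at a
  two-sided-pinned unit gives the (ND) clause of child 2 for every canonically normalised exactly centred scheme;
* `FiniteSizeShiftFloor` — TRANSFER T3 (finite-size scaling / Lüscher's pole term, child 3): the finite-size
  effective-mass shift floor at tori of a few correlation lengths, rate `e^{-c m̂ S}` with `c < 1` (typed first lemma of the crux idea
  `luscher-pole-term-skewness`);
* `HierarchyAt` — NEGATION N1: the two-scale ("hierarchy") scenario `ξ_k Λ_P,k → ∞` under which child 2's canonical
  floor fails while the crux may still hold with a non-canonical `c_k` — unconstructible, and its negation is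
  exactly the one-scale content of (ND), so it yields no stub.
-/

noncomputable section

namespace Summit.QuantumFields.YangMills.Cruxes.ContinuumLegGivenGap.StrategistS1

open scoped SchwartzMap
open Filter Topology MeasureTheory
open Literature.MathematicalPhysics.QuantumFieldTheory Literature.MathematicalPhysics.QuantumLattice
  Literature.MathematicalPhysics.AQFT Literature.Probability.LatticeModels
open scoped Classical BigOperators

/-- Child 2 of the split, SET-shaped (verbatim the registered `stub_uvPackageVol`). -/
def SetUVEngine : Prop :=
  ∀ (G : Type) [Group G] [TopologicalSpace G] [IsTopologicalGroup G] [CompactSpace G] [MeasurableSpace G] [BorelSpace G], IsCompactSimpleLieGroup G → ∃ r : LatticeRep G, ∀ (β : ℕ → ℝ) (mh : ℕ → ℝ) (S₁ : ℕ → ℕ) (K : ℝ), Tendsto β atTop atTop → (∀ k, 0 < mh k) → 0 < K → (∀ A B : YMSpecies G, ∃ C : ℝ, ∀ k S n : ℕ, S₁ k ≤ S → n ≤ S → |latticeConnectedCorr r.ρ (β k) (2 * S + 1) A.F B.F n| ≤ C * Real.exp (-(mh k * n))) → (∀ k S₀ : ℕ, ∃ A B : YMSpecies G, ∀ C : ℝ,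 ∃ S n : ℕ, S₀ ≤ S ∧ n ≤ S ∧ C * Real.exp (-(K * mh k * n)) < |latticeConnectedCorr r.ρ (β k) (2 * S + 1) A.F B.F n|) → Tendsto mh atTop (𝓝 0) → ∃ (a : ℕ → ℝ) (φ : ℕ → ℕ) (Δ₀ : ℝ) (𝓛 : ℕ → Set ℕ), (∀ k, 0 < a k) ∧ StrictMono φ ∧ 0 < Δ₀ ∧ (∀ k, Δ₀ * a k ≤ mh (φ k)) ∧ (∀ k S : ℕ, ∃ S' : ℕ, S' ∈ 𝓛 k ∧ S ≤ S') ∧ (∀ k : ℕ, ∀ S ∈ 𝓛 k, S₁ (φ k) ≤ S) ∧ (∃ N : ℕ, 1 ≤ N ∧ ∀ᶠ k in atTop, ∀ S ∈ 𝓛 k, (a k)⁻¹ ≤ (a k * (S : ℝ)) ^ N) ∧ ∀ (sch : SpeciesScheme (YMSpecies G)), (∀ k, sch.a k = a k) → (∀ k, sch.β k = β (φ k)) → (∀ k, sch.L k ∈ 𝓛 k) → ∀ (LS : (k n : ℕ) → SchwartzMap (Fin n → EuclideanSpace ℝ (Fin 4)) ℂ → ℂ), (∀ (k n : ℕ) (F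 : SchwartzMap (Fin n → EuclideanSpace ℝ (Fin 4)) ℂ), LS k n F = ∫ U : GaugeConfig 4 (sch.side k) G, ∑ x : Fin n → ↥(Literature.Probability.LatticeModels.box 4 (sch.L k)), F (fun i => sch.a k • siteToE ↑(x i)) * ∏ i, ((sch.c r.curvature k * sch.a k ^ 4 * (r.curvature.F (Literature.MathematicalPhysics.QuantumLattice.configShift (-↑(x i)) (Literature.MathematicalPhysics.QuantumLattice.torusLift (sch.side k) U)) - sch.m r.curvature k) : ℝ) : ℂ) ∂(wilsonMeasure r.ρ (sch.β k))) → (∀ k : ℕ, sch.m r.curvature k = ∫ U : GaugeConfig 4 (sch.side k) G, r.curvature.F (Literature.MathematicalPhysics.QuantumLattice.torusLift (sch.side k) U) ∂(wilsonMeasure r.ρ (sch.β k))) → (∀ k : ℕ, sch.c r.curvature k = (sch.a k ^ 4)⁻¹) → (∃ (s : ℕ) (α β' : ℝ), ∀ᶠ k in atTop, ∀ (p : ℕ) (q : Fin p → {q : Fin 4 × Fin 4 // q.1 < q.2}) (F : SchwartzMap (Fin p → EuclideanSpace ℝ (Fin 4)) ℂ), IsOffDiagonal F → ‖∫ U : GaugeConfig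 4 (sch.side k) G, ∑ x : Fin p → ↥(Literature.Probability.LatticeModels.box 4 (sch.L k)), F (fun i => sch.a k • siteToE ↑(x i)) * ∏ i, ((plaquetteObs r.ρ 0 (q i).1.1 (q i).1.2 (Literature.MathematicalPhysics.QuantumLattice.configShift (-↑(x i)) (Literature.MathematicalPhysics.QuantumLattice.torusLift (sch.side k) U)) - wilsonTorusMean r.ρ (sch.β k) (sch.L k) (plaquetteObs r.ρ 0 (q i).1.1 (q i).1.2) : ℝ) : ℂ) ∂(wilsonMeasure r.ρ (sch.β k))‖ ≤ α * (p.factorial : ℝ) ^ β' * schwartzNorm (p * s) F) ∧ (∃ (f g : SchwartzMap (Fin 1 → EuclideanSpace ℝ (Fin 4)) ℂ) (H : SchwartzMap (Fin (1 + 1) → EuclideanSpace ℝ (Fin 4)) ℂ), IsTimeOrdered f ∧ IsTimeOrdered g ∧ IsAppendTensorOf H (osAdjoint f) g ∧ ∃ δ : ℝ, 0 < δ ∧ ∀ᶠ k in atTop, δ ≤ ‖LS k (1 + 1) H‖) ∧ (∀ R : EuclideanSpace ℝ (Fin 4) ≃ₗᵢ[ℝ] EuclideanSpace ℝ (Fin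 4), R (EuclideanSpace.single 0 1) = (3 / 5 : ℝ) • EuclideanSpace.single 0 1 + (-(4 / 5) : ℝ) • EuclideanSpace.single 1 1 → R (EuclideanSpace.single 1 1) = (4 / 5 : ℝ) • EuclideanSpace.single 0 1 + (3 / 5 : ℝ) • EuclideanSpace.single 1 1 → R (EuclideanSpace.single 2 1) = EuclideanSpace.single 2 1 → R (EuclideanSpace.single 3 1) = EuclideanSpace.single 3 1 → ∀ (n : ℕ) (F : SchwartzMap (Fin n → EuclideanSpace ℝ (Fin 4)) ℂ), IsOffDiagonal F → Tendsto (fun k : ℕ => LS k n (linActMulti R F) - LS k n F) atTop (𝓝 0))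

/-- STRENGTHEN S1: the TAIL-shaped child 2 (`stub_floorAndRotation`'s shape with (UUVB) re-inserted). -/
def TailUVEngine : Prop :=
  ∀ (G : Type) [Group G] [TopologicalSpace G] [IsTopologicalGroup G] [CompactSpace G] [MeasurableSpace G] [BorelSpace G], IsCompactSimpleLieGroup G → ∃ r : LatticeRep G, ∀ (β : ℕ → ℝ) (mh : ℕ → ℝ) (S₁ : ℕ → ℕ) (K : ℝ), Tendsto β atTop atTop → (∀ k, 0 < mh k) → 0 < K → (∀ A B : YMSpecies G, ∃ C : ℝ, ∀ k S n : ℕ, S₁ k ≤ S → n ≤ S → |latticeConnectedCorr r.ρ (β k) (2 * S + 1) A.F B.F n| ≤ C * Real.exp (-(mh k * n))) → (∀ k S₀ : ℕ, ∃ A B : YMSpecies G, ∀ C : ℝ, ∃ S n : ℕ, S₀ ≤ S ∧ n ≤ S ∧ C * Real.exp (-(K * mh k * n)) < |latticeConnectedCorr r.ρ (β k) (2 * S + 1) A.F B.F n|) → Tendsto mh atTop (𝓝 0) → ∃ (a : ℕ → ℝ) (φ : ℕ → ℕ) (Δ₀ : ℝ) (Λ₀ : ℕ → ℕ), (∀ k,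 0 < a k) ∧ StrictMono φ ∧ 0 < Δ₀ ∧ (∀ k, Δ₀ * a k ≤ mh (φ k)) ∧ (∀ k, S₁ (φ k) ≤ Λ₀ k) ∧ (∃ N : ℕ, 1 ≤ N ∧ ∀ᶠ k in atTop, ∀ S : ℕ, Λ₀ k ≤ S → (a k)⁻¹ ≤ (a k * (S : ℝ)) ^ N) ∧ ∀ (sch : SpeciesScheme (YMSpecies G)), (∀ k, sch.a k = a k) → (∀ k, sch.β k = β (φ k)) → (∀ k, Λ₀ k ≤ sch.L k) → ∀ (LS : (k n : ℕ) → SchwartzMap (Fin n → EuclideanSpace ℝ (Fin 4)) ℂ → ℂ), (∀ (k n : ℕ) (F : SchwartzMap (Fin n → EuclideanSpace ℝ (Fin 4)) ℂ), LS k n F = ∫ U : GaugeConfig 4 (sch.side k) G, ∑ x : Fin n → ↥(Literature.Probability.LatticeModels.box 4 (sch.L k)), F (fun i => sch.a k • siteToE ↑(x i)) * ∏ i, ((sch.c r.curvature k * sch.a k ^ 4 * (r.curvature.F (Literature.MathematicalPhysics.QuantumLattice.configShift (-↑(x i)) (Literature.MathematicalPhysics.QuantumLattice.torusLift (sch.side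 k) U)) - sch.m r.curvature k) : ℝ) : ℂ) ∂(wilsonMeasure r.ρ (sch.β k))) → (∀ k : ℕ, sch.m r.curvature k = ∫ U : GaugeConfig 4 (sch.side k) G, r.curvature.F (Literature.MathematicalPhysics.QuantumLattice.torusLift (sch.side k) U) ∂(wilsonMeasure r.ρ (sch.β k))) → (∀ k : ℕ, sch.c r.curvature k = (sch.a k ^ 4)⁻¹) → (∃ (s : ℕ) (α β' : ℝ), ∀ᶠ k in atTop, ∀ (p : ℕ) (q : Fin p → {q : Fin 4 × Fin 4 // q.1 < q.2}) (F : SchwartzMap (Fin p → EuclideanSpace ℝ (Fin 4)) ℂ), IsOffDiagonal F → ‖∫ U : GaugeConfig 4 (sch.side k) G, ∑ x : Fin p → ↥(Literature.Probability.LatticeModels.box 4 (sch.L k)), F (fun i => sch.a k • siteToE ↑(x i)) * ∏ i, ((plaquetteObs r.ρ 0 (q i).1.1 (q i).1.2 (Literature.MathematicalPhysics.QuantumLattice.configShift (-↑(x i)) (Literature.MathematicalPhysics.QuantumLattice.torusLift (sch.side k) U)) - wilsonTorusMean r.ρ (sch.β k) (sch.L k) (plaquetteObs r.ρ 0 (q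 i).1.1 (q i).1.2) : ℝ) : ℂ) ∂(wilsonMeasure r.ρ (sch.β k))‖ ≤ α * (p.factorial : ℝ) ^ β' * schwartzNorm (p * s) F) ∧ (∃ (f g : SchwartzMap (Fin 1 → EuclideanSpace ℝ (Fin 4)) ℂ) (H : SchwartzMap (Fin (1 + 1) → EuclideanSpace ℝ (Fin 4)) ℂ), IsTimeOrdered f ∧ IsTimeOrdered g ∧ IsAppendTensorOf H (osAdjoint f) g ∧ ∃ δ : ℝ, 0 < δ ∧ ∀ᶠ k in atTop, δ ≤ ‖LS k (1 + 1) H‖) ∧ (∀ R : EuclideanSpace ℝ (Fin 4) ≃ₗᵢ[ℝ] EuclideanSpace ℝ (Fin 4), R (EuclideanSpace.single 0 1) = (3 / 5 : ℝ) • EuclideanSpace.single 0 1 + (-(4 / 5) : ℝ) • EuclideanSpace.single 1 1 → R (EuclideanSpace.single 1 1) = (4 / 5 : ℝ) • EuclideanSpace.single 0 1 + (3 / 5 : ℝ) • EuclideanSpace.single 1 1 → R (EuclideanSpace.single 2 1) = EuclideanSpace.single 2 1 → R (EuclideanSpace.single 3 1) = EuclideanSpace.single 3 1 → ∀ (n :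 ℕ) (F : SchwartzMap (Fin n → EuclideanSpace ℝ (Fin 4)) ℂ), IsOffDiagonal F → Tendsto (fun k : ℕ => LS k n (linActMulti R F) - LS k n F) atTop (𝓝 0))

/-- S1 is a genuine strengthening: TAIL ⇒ SET with `𝓛 k := {L | Λ₀ k ≤ L}`. -/
theorem setUVEngine_of_tail : TailUVEngine → SetUVEngine := by
  intro h G _ _ _ _ _ _ hG
  obtain ⟨r, hr⟩ := h G hG
  refine ⟨r, fun β mh S₁ K hβ hmh hK hU hS hcrit => ?_⟩
  obtain ⟨a, φ, Δ₀, Λ₀, ha, hφ, hΔ₀, hpin, hS₁, ⟨N, hN1, hpoly⟩, hIR⟩ := hr β mh S₁ K hβ hmh hK hU hS hcrit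
  refine ⟨a, φ, Δ₀, fun k => {L | Λ₀ k ≤ L}, ha, hφ, hΔ₀, hpin, ?_, ?_, ⟨N, hN1, ?_⟩, ?_⟩
  · intro k S
    exact ⟨max S (Λ₀ k), show Λ₀ k ≤ max S (Λ₀ k) from le_max_right _ _, le_max_left _ _⟩
  · intro k S hSk
    exact (hS₁ k).trans (show Λ₀ k ≤ S from hSk)
  · exact hpoly.mono fun k hk S hSk => hk S (show Λ₀ k ≤ S from hSk)
  · intro sch hsa hsβ hsL LS hLS hm hc
    exact hIR sch hsa hsβ (fun k => hsL k) LS hLS hm hc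

variable {G : Type} [Group G] [TopologicalSpace G] [IsTopologicalGroup G] [CompactSpace G]
  [MeasurableSpace G] [BorelSpace G]

/-- The zero-momentum connected two-point function of the curvature species on the torus of side `2S+1` at inverse
coupling `b` and Euclidean time `n` (lattice units, bare = canonically normalised up to `a⁸·a⁻³`): `Σ_{x⃗} ⟨P_0 ; P_{(n,x⃗)}⟩`. -/
def zmCorr (r : LatticeRep G) (b : ℝ) (S n : ℕ) : ℝ :=
  ∑ x : Fin 3 → Fin (2 * S + 1),
    ((∫ U : GaugeConfig 4 (2 * S + 1) G, r.curvature.F (torusLift (2 * S + 1) U) *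
        r.curvature.F (configShift (-(Fin.cons (n : ℤ) (fun i => ((x i).val : ℤ)) : Fin 4 → ℤ))
          (torusLift (2 * S + 1) U)) ∂(wilsonMeasure r.ρ b)) -
      (∫ U : GaugeConfig 4 (2 * S + 1) G, r.curvature.F (torusLift (2 * S + 1) U) ∂(wilsonMeasure r.ρ b)) ^ 2)

/-- D3 / T1: the **zero-momentum floor** at the correlation length, in infrared currency (no scheme, no test functions):
along every locked critical datum, for times `n` with `m̂_k n ∈ [θ₁, θ₂]` and tori `S ≥ S₁ k`, `m̂_k S ≥ K₀`:
`zmCorr ≥ c · m̂_k⁵`.  Physically: the canonically normalised scalar-glueball residue (decay constant) is bounded below;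
"the plaquette running coupling `g_P(n)⁴ := n⁸ G(n)/C_free` reaches order one at `n ≍ ξ`". Open (one-scale content of (ND)). -/
def ZeroMomentumFloor : Prop :=
  ∀ (G : Type) [Group G] [TopologicalSpace G] [IsTopologicalGroup G] [CompactSpace G] [MeasurableSpace G] [BorelSpace G], IsCompactSimpleLieGroup G → ∀ (r : LatticeRep G) (β : ℕ → ℝ) (mh : ℕ → ℝ) (S₁ : ℕ → ℕ), Tendsto β atTop atTop → (∀ k, 0 < mh k) → (∀ A B : YMSpecies G, ∃ C : ℝ, ∀ k S n : ℕ, S₁ k ≤ S → n ≤ S → |latticeConnectedCorr r.ρ (β k) (2 * S + 1) A.F B.F n| ≤ C * Real.exp (-(mh k * n))) → Tendsto mh atTop (𝓝 0) → ∃ (c θ₁ θ₂ K₀ : ℝ) (k₀ : ℕ), 0 < c ∧ 0 < θ₁ ∧ θ₁ < θ₂ ∧ ∀ k : ℕ, k₀ ≤ k → ∀ S : ℕ, S₁ k ≤ S → K₀ ≤ mh k * S → ∀ n : ℕ, θ₁ ≤ mh k * n → mh k * n ≤ θ₂ → c * mh k ^ 5 ≤ zmCorr r (β k) S n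

/-- D3: the **RP bridge** from the zero-momentum floor to child 2's (ND) clause for every canonically normalised, exactly
centred scheme at a two-sided-pinned unit (`Δ₀ a_k ≤ m̂(φ k) ≤ K₁ a_k`) on tori beyond `Λ₀ k` with `m̂ Λ₀ ≥ K₀` eventually.
Plausibly provable (M/L): `LS k 2 (θg ⊗ g) = Σ g(θ·)g G ≥ 0` by odd-torus RP, zero-momentum reduction by a wide spatial
profile, window bookkeeping; NOT proved here. -/
def NDOfZeroMomentumFloor : Prop :=
  ∀ (G : Type) [Group G] [TopologicalSpace G] [IsTopologicalGroup G] [CompactSpace G] [MeasurableSpace G] [BorelSpace G], IsCompactSimpleLieGroup G → ∀ (r : LatticeRep G) (β : ℕ → ℝ) (mh : ℕ → ℝ) (S₁ : ℕ → ℕ), Tendsto β atTop atTop → (∀ k, 0 < mh k) → (∀ A B : YMSpecies G, ∃ C : ℝ, ∀ k S n : ℕ, S₁ k ≤ S → n ≤ S → |latticeConnectedCorr r.ρ (β k) (2 * S + 1) A.F B.F n| ≤ C * Real.exp (-(mh k * n))) → ∀ (c θ₁ θ₂ K₀ : ℝ) (k₀ : ℕ), 0 < c → 0 < θ₁ → θ₁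 < θ₂ → (∀ k : ℕ, k₀ ≤ k → ∀ S : ℕ, S₁ k ≤ S → K₀ ≤ mh k * S → ∀ n : ℕ, θ₁ ≤ mh k * n → mh k * n ≤ θ₂ → c * mh k ^ 5 ≤ zmCorr r (β k) S n) → ∀ (a : ℕ → ℝ) (φ : ℕ → ℕ) (Δ₀ K₁ : ℝ) (Λ₀ : ℕ → ℕ), (∀ k, 0 < a k) → StrictMono φ → 0 < Δ₀ → (∀ k, Δ₀ * a k ≤ mh (φ k)) → (∀ k, mh (φ k) ≤ K₁ * a k) → (∀ k, S₁ (φ k) ≤ Λ₀ k) → (∀ᶠ k in atTop, K₀ ≤ mh (φ k) * Λ₀ k) → ∀ (sch : SpeciesScheme (YMSpecies G)), (∀ k, sch.a k = a k) → (∀ k, sch.β k = β (φ k)) → (∀ k, Λ₀ k ≤ sch.L k) → ∀ (LS : (k n : ℕ) → SchwartzMap (Fin n → EuclideanSpace ℝ (Fin 4)) ℂ → ℂ), (∀ (k n : ℕ) (F : SchwartzMap (Fin n → EuclideanSpace ℝ (Fin 4)) ℂ), LS k n F = ∫ U : GaugeConfig 4 (sch.side k) G, ∑ x : Fin n → ↥(Literature.Probability.LatticeModels.box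 4 (sch.L k)), F (fun i => sch.a k • siteToE ↑(x i)) * ∏ i, ((sch.c r.curvature k * sch.a k ^ 4 * (r.curvature.F (Literature.MathematicalPhysics.QuantumLattice.configShift (-↑(x i)) (Literature.MathematicalPhysics.QuantumLattice.torusLift (sch.side k) U)) - sch.m r.curvature k) : ℝ) : ℂ) ∂(wilsonMeasure r.ρ (sch.β k))) → (∀ k : ℕ, sch.m r.curvature k = ∫ U : GaugeConfig 4 (sch.side k) G, r.curvature.F (Literature.MathematicalPhysics.QuantumLattice.torusLift (sch.side k) U) ∂(wilsonMeasure r.ρ (sch.β k))) → (∀ k : ℕ, sch.c r.curvature k = (sch.a k ^ 4)⁻¹) → (∃ (f g : SchwartzMap (Fin 1 → EuclideanSpace ℝ (Fin 4)) ℂ) (H : SchwartzMap (Fin (1 + 1) → EuclideanSpace ℝ (Fin 4)) ℂ), IsTimeOrdered f ∧ IsTimeOrdered g ∧ IsAppendTensorOf H (osAdjoint f) g ∧ ∃ δ : ℝ, 0 < δ ∧ ∀ᶠ k in atTop, δ ≤ ‖LS k (1 + 1) H‖)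


/-- T3 (transfer from finite-size scaling theory; crux idea `luscher-pole-term-skewness`, child 3): the **finite-size
shift floor** in infrared currency. Along a locked critical datum, on tori of side `S` with `m̂_k S ∈ [θ₁, θ₂]` (a few
correlation lengths) the zero-momentum plaquette effective mass at times `n` with `m̂_k n ∈ [θ₃, θ₄]` is SMALLER than on
every much larger torus `S' ≥ S²` in the clustering regime by at least `η m̂_k e^{-c m̂_k S}` with `c < 1` — the shadow of
Lüscher's pole term `−(3λ²/16πm²L) e^{−(√3/2) m L}` (`c = √3/2 < 1` beats the two-particle `e^{−mL}`), whose coefficient is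
the square of the triple-glueball coupling `λ` = the on-shell residue of `κ₃` of the interpolating field `tr F²`; measured:
`G²/4π = 60 ± 25` for SU(3) from finite-size effects (Montvay–Münster (3.457), Schierholz 1989). Written multiplicatively
(`m_eff,L(n) = log G_L(n)/G_L(n+1)`), with the positivity it presupposes. Open; k-uniformity is the content. -/
def FiniteSizeShiftFloor : Prop :=
  ∀ (G : Type) [Group G] [TopologicalSpace G] [IsTopologicalGroup G] [CompactSpace G] [MeasurableSpace G] [BorelSpace G], IsCompactSimpleLieGroup G → ∀ (r : LatticeRep G) (β : ℕ → ℝ) (mh : ℕ → ℝ) (S₁ : ℕ → ℕ), Tendsto β atTop atTop → (∀ k, 0 < mh k) → (∀ A B : YMSpecies G, ∃ C : ℝ, ∀ k S n : ℕ, S₁ k ≤ S → n ≤ S → |latticeConnectedCorr r.ρ (β k) (2 * S + 1) A.F B.F n| ≤ C * Real.exp (-(mh k * n))) → Tendsto mh atTop (𝓝 0) → ∃ (η c θ₁ θ₂ θ₃ θ₄ : ℝ) (k₀ : ℕ), 0 < η ∧ 0 < c ∧ c < 1 ∧ 0 < θ₁ ∧ θ₁ < θ₂ ∧ 0 < θ₃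 ∧ θ₃ < θ₄ ∧ ∀ k : ℕ, k₀ ≤ k → ∀ S : ℕ, θ₁ ≤ mh k * S → mh k * S ≤ θ₂ → ∀ S' : ℕ, S₁ k ≤ S' → S * S ≤ S' → ∀ n : ℕ, θ₃ ≤ mh k * n → mh k * n ≤ θ₄ → 2 * (n + 1) ≤ S → 0 < zmCorr r (β k) S n ∧ 0 < zmCorr r (β k) S (n + 1) ∧ 0 < zmCorr r (β k) S' n ∧ 0 < zmCorr r (β k) S' (n + 1) ∧ Real.exp (η * mh k * Real.exp (-(c * mh k * S))) * (zmCorr r (β k) S' (n + 1) * zmCorr r (β k) S n) ≤ zmCorr r (β k) S' n * zmCorr r (β k) S (n + 1)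

/-- N1: the **hierarchy scenario** at a datum — the zero-momentum correlator stays below EVERY multiple of `m̂⁵` on the whole
sub-correlation-length range (the plaquette coupling never reaches order one before `ξ`): under it the canonical floor of
child 2 fails although the crux could still hold with non-canonical `c_k`. Unconstructible (contradicts one-scale YM);
its negation is (ND)'s content, not a lemma. -/
def HierarchyAt (r : LatticeRep G) (β mh : ℕ → ℝ) (S₁ : ℕ → ℕ) : Prop :=
  ∀ (c θ₂ K₀ : ℝ), 0 < c → 0 < θ₂ → ∀ᶠ k in atTop, ∀ S : ℕ, S₁ k ≤ S → K₀ ≤ mh k * S → ∀ n : ℕ, 1 ≤ n → mh k * n ≤ θ₂ → zmCorr r (β k) S n ≤ c * mh k ^ 5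

end Summit.QuantumFields.YangMills.Cruxes.ContinuumLegGivenGap.StrategistS1

end
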